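import Mathlib.InformationTheory.Hamming
import Mathlib.Data.Matrix.Mul
import Mathlib.Algebra.Module.Submodule.Basic
import Mathlib.LinearAlgebra.Span.Defs
import Mathlib.Algebra.Field.ZMod
import HarnessLib

/-!
# The linked-cluster lemma: a minimum-weight codeword (or minimum-weight logical operator) has connected support

Kovalev–Dumer–Pryadko, *Linked-cluster technique for finding the distance of a quantum LDPC
code*, ITA 2013 = arXiv:1302.1845 [KovalevDumerPryadko2013], §4 Theorem 1: for a code with
parity-check matrix `H`, make the positions `1..n` the vertices of a graph `G₁` in which "two
nodes are connected by an edge iff there is a row in the parity check matrix which has non-zero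
values at both positions"; then "**Theorem 1.** The support of a minimum-weight code word of a
`q`-ary code with the parity check matrix `H` forms a linked cluster on `G₁`." Proof (ibid.): if
the support split into two parts affecting disjoint sets of rows, each part would itself be in the
null-space of `H`, contradicting minimality. Dumer–Kovalev–Pryadko, *Distance verification for
classical and quantum LDPC codes*, IEEE Trans. Inform. Theory 63 (2017) = arXiv:1611.07164
[DumerKovalevPryadko2017], §5 restate it through irreducibility ("Definition 1 … a codeword `c` is
irreducible if it cannot be represented as a linear combination of two codewords with
non-overlapping supports. Lemma 3. A minimum-weight codeword of a linear code is irreducible") and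
run the resulting irreducible-cluster search for quantum stabilizer codes, where one "also
verif[ies] the restriction `c ∈ C⊥ ∖ C`" (§5, IC algorithm).

This file PROVES the lemma over `𝔽₂` in the cut form that a cluster-growing enumerator consumes —
every split of the support into a part inside a coordinate set `A` and a part outside `A`, both
non-empty, is crossed by a row of `H` — and in the RELATIVE form needed for stabilizer / CSS codes:
if `H v = 0`, `v ∉ W` for a subspace `W` (the stabilizer part, e.g. the row space of `H_Z` when `H =
H_X`), and every `u` with `H u = 0` of smaller weight lies in `W` (i.e. `v` is a minimum-weight
logical operator), then the support of `v` is linked (`exists_crossing_row_of_isMinWeightOutside`);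
the classical Theorem 1 is the case `W = ⊥` (`exists_crossing_row_of_isMinWeightCodeword`), and the
CSS `Z`-side statement is `css_exists_crossing_row` (X-checks `H_X`, `W` = row space of `H_Z`).
These are the completeness lemmas behind distance certificates by connected-cluster enumeration
(LADDER-QEC, kernel A): to show `d_Z ≥ d` it suffices to rule out `H_X`-linked supports of size
`< d`.

## References

* A. A. Kovalev, I. Dumer, L. P. Pryadko, ITA 2013, arXiv:1302.1845, §4 Theorem 1 and its proof.
* I. Dumer, A. A. Kovalev, L. P. Pryadko, IEEE TIT 63 (2017) 4675, arXiv:1611.07164, §5 Def. 1,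
  Lemma 3, IC algorithm ("For a quantum stabilizer code, we also verify the restriction c ∈ C⊥∖C").

## Mathlib / tree search

No `linked cluster` / `irreducible codeword` notion in Mathlib or the tree (`lean search
'irreducible codeword|linked cluster|LinkedCluster'`, 2026-08-26). Uses only `Matrix.mulVec`,
`hammingNorm`, `Submodule`. The graph `G₁` is kept implicit (the adjacency `∃ r, H r i ≠ 0 ∧
H r j ≠ 0` appears verbatim in the conclusions) so that no `SimpleGraph` connectivity API is
needed by computable checkers; a `SimpleGraph.Connected` corollary can be added by a user.
-/

namespace Literature.InformationTheory.QuantumCodes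

open Matrix Finset

variable {m n : ℕ}

/-! ### Restricting a vector to a coordinate set -/

/-- The restriction `v|_A` of `v ∈ 𝔽₂ⁿ` to the coordinate set `A` (zero outside `A`): the
"subset of non-zero symbols" of the cited proof. [cite: KovalevDumerPryadko2013, §4 proof of Theorem 1] -/
def restrictTo (A : Finset (Fin n)) (v : Fin n → ZMod 2) : Fin n → ZMod 2 :=
  fun i => if i ∈ A then v i else 0

/-- Value of the restriction inside `A`. [cite: KovalevDumerPryadko2013, §4 proof of Theorem 1] -/
@[simp] theorem restrictTo_apply_of_mem {A : Finset (Fin n)} {v : Fin n → ZMod 2} {i : Fin n}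
    (hi : i ∈ A) : restrictTo A v i = v i := by
  simp [restrictTo, hi]

/-- Value of the restriction outside `A`. [cite: KovalevDumerPryadko2013, §4 proof of Theorem 1] -/
@[simp] theorem restrictTo_apply_of_not_mem {A : Finset (Fin n)} {v : Fin n → ZMod 2} {i : Fin n}
    (hi : i ∉ A) : restrictTo A v i = 0 := by
  simp [restrictTo, hi]

/-- `v = v|_A + v|_{Aᶜ}`. [cite: KovalevDumerPryadko2013, §4 proof of Theorem 1] -/
theorem restrictTo_add_restrictTo_compl (A : Finset (Fin n)) (v : Fin n → ZMod 2) :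
    restrictTo A v + restrictTo Aᶜ v = v := by
  funext i
  by_cases hi : i ∈ A
  · simp [hi]
  · simp [hi]

/-- The weight of `v|_A` counts the support of `v` inside `A`.
[cite: KovalevDumerPryadko2013, §4 proof of Theorem 1] -/
theorem hammingNorm_restrictTo (A : Finset (Fin n)) (v : Fin n → ZMod 2) :
    hammingNorm (restrictTo A v) = #{i | i ∈ A ∧ v i ≠ 0} := by
  unfold hammingNorm
  congr 1
  ext i
  by_cases hi : i ∈ A <;> simp [hi]

/-- If `v` has support outside `A`, then `v|_A` is strictly lighter than `v`.
[cite: KovalevDumerPryadko2013, §4 proof of Theorem 1] -/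
theorem hammingNorm_restrictTo_lt {A : Finset (Fin n)} {v : Fin n → ZMod 2} {j : Fin n}
    (hj : j ∉ A) (hvj : v j ≠ 0) : hammingNorm (restrictTo A v) < hammingNorm v := by
  rw [hammingNorm_restrictTo]
  unfold hammingNorm
  apply card_lt_card
  rw [ssubset_iff_of_subset (fun i hi => by simp only [mem_filter, mem_univ, true_and] at hi ⊢; exact hi.2)]
  exact ⟨j, by simp [hvj], by simp [hj]⟩

/-! ### Rows do not cross the cut ⇒ both halves are in the kernel -/

/-- If `H v = 0` and NO row of `H` is non-zero both at a support position of `v` inside `A` and at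
a support position of `v` outside `A`, then `H (v|_A) = 0` ("these affect different rows of the
parity check matrix and, therefore, the vectors corresponding to subsets of non-zero symbols in `c`
are in the null-space of `H`"). [cite: KovalevDumerPryadko2013, §4 proof of Theorem 1] -/
theorem mulVec_restrictTo_eq_zero (H : Matrix (Fin m) (Fin n) (ZMod 2)) {A : Finset (Fin n)}
    {v : Fin n → ZMod 2} (hv : H *ᵥ v = 0)
    (hcut : ∀ r i j, i ∈ A → j ∉ A → v i ≠ 0 → v j ≠ 0 → H r i ≠ 0 → H r j = 0) :
    H *ᵥ restrictTo A v = 0 := by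
  funext r
  have hvr : ∑ j, H r j * v j = 0 := by
    have := congrFun hv r
    simpa [mulVec, dotProduct] using this
  simp only [mulVec, dotProduct, Pi.zero_apply]
  by_cases hrow : ∃ i ∈ A, v i ≠ 0 ∧ H r i ≠ 0
  · -- the row meets the support inside `A`, hence misses it outside `A`: the sum is the full one
    obtain ⟨i, hiA, hvi, hHi⟩ := hrow
    rw [← hvr]
    refine sum_congr rfl fun j _ => ?_
    by_cases hj : j ∈ A
    · simp [hj]
    · by_cases hvj : v j = 0
      · simp [hj, hvj]
      · simp [hj, hcut r i j hiA hj hvi hvj hHi]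
  · -- the row misses the support inside `A`: every term vanishes
    push Not at hrow
    refine sum_eq_zero fun j _ => ?_
    by_cases hj : j ∈ A
    · by_cases hvj : v j = 0
      · simp [hj, hvj]
      · simp [hj, hrow j hj hvj]
    · simp [hj]

/-! ### The linked-cluster lemma -/

/-- `v` is a **minimum-weight element of `ker H` outside `W`**: `H v = 0`, `v ∉ W`, and every
`u` with `H u = 0`, `u ∉ W` weighs at least as much as `v`. For `W = ⊥` this says `v` is a
minimum-weight (non-zero) codeword of the code with parity-check matrix `H`; for a CSS code with
`H = H_X` and `W` the row space of `H_Z` it says `v` is a minimum-weight logical `Z`-operator.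
[cite: DumerKovalevPryadko2017, §5 (IC algorithm: "For a quantum stabilizer code, we also verify the restriction c ∈ C⊥∖C")] -/
def IsMinWeightOutside (H : Matrix (Fin m) (Fin n) (ZMod 2)) (W : Submodule (ZMod 2) (Fin n → ZMod 2))
    (v : Fin n → ZMod 2) : Prop :=
  H *ᵥ v = 0 ∧ v ∉ W ∧ ∀ u, H *ᵥ u = 0 → u ∉ W → hammingNorm v ≤ hammingNorm u

/-- **Linked-cluster lemma, relative form.** If `v` is a minimum-weight element of `ker H`
outside the subspace `W`, then for every coordinate set `A` meeting the support of `v` but not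
containing it, some row of `H` is non-zero at a support position inside `A` AND at a support
position outside `A` — the support of `v` is a linked cluster of the graph `G₁(H)`. (Else
`v|_A`, `v|_{Aᶜ}` are lighter kernel vectors, hence in `W`, so `v = v|_A + v|_{Aᶜ} ∈ W`.) This is
the statement the irreducible-cluster search uses for stabilizer codes.
[cite: DumerKovalevPryadko2017, §5 Lemma 3 with the IC algorithm's restriction c ∈ C⊥∖C] -/
theorem exists_crossing_row_of_isMinWeightOutside {H : Matrix (Fin m) (Fin n) (ZMod 2)}
    {W : Submodule (ZMod 2) (Fin n → ZMod 2)} {v : Fin n → ZMod 2} (hv : IsMinWeightOutside H W v)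
    (A : Finset (Fin n)) (hA : ∃ i ∈ A, v i ≠ 0) (hAc : ∃ j ∉ A, v j ≠ 0) :
    ∃ r i j, i ∈ A ∧ j ∉ A ∧ v i ≠ 0 ∧ v j ≠ 0 ∧ H r i ≠ 0 ∧ H r j ≠ 0 := by
  obtain ⟨hHv, hvW, hmin⟩ := hv
  by_contra hcon
  push Not at hcon
  -- both halves are kernel vectors
  have hA0 : H *ᵥ restrictTo A v = 0 := mulVec_restrictTo_eq_zero H hHv hcon
  have hAc0 : H *ᵥ restrictTo Aᶜ v = 0 := by
    refine mulVec_restrictTo_eq_zero H hHv fun r i j hi hj hvi hvj hHi => ?_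
    rw [mem_compl] at hi
    rw [mem_compl, not_not] at hj
    by_contra hHj
    exact hHi (hcon r j i hj hi hvj hvi hHj)
  -- both halves are strictly lighter, hence in `W`
  obtain ⟨i, hiA, hvi⟩ := hA
  obtain ⟨j, hjA, hvj⟩ := hAc
  have hltA : hammingNorm (restrictTo A v) < hammingNorm v := hammingNorm_restrictTo_lt hjA hvj
  have hltAc : hammingNorm (restrictTo Aᶜ v) < hammingNorm v :=
    hammingNorm_restrictTo_lt (by simpa using hiA) hvi
  have hWA : restrictTo A v ∈ W := by
    by_contra h; exact absurd (hmin _ hA0 h) (not_le.mpr hltA)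
  have hWAc : restrictTo Aᶜ v ∈ W := by
    by_contra h; exact absurd (hmin _ hAc0 h) (not_le.mpr hltAc)
  have : v ∈ W := by
    rw [← restrictTo_add_restrictTo_compl A v]
    exact W.add_mem hWA hWAc
  exact hvW this

/-- `v` is a **minimum-weight codeword** of the binary code with parity-check matrix `H`: a non-zero
kernel vector of least Hamming weight. [cite: KovalevDumerPryadko2013, §4 Theorem 1] -/
def IsMinWeightCodeword (H : Matrix (Fin m) (Fin n) (ZMod 2)) (v : Fin n → ZMod 2) : Prop :=
  H *ᵥ v = 0 ∧ v ≠ 0 ∧ ∀ u, H *ᵥ u = 0 → u ≠ 0 → hammingNorm v ≤ hammingNorm u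

/-- A minimum-weight codeword is a minimum-weight kernel element outside `W = ⊥`. [cite: KovalevDumerPryadko2013, §4 Theorem 1] -/
theorem IsMinWeightCodeword.isMinWeightOutside_bot {H : Matrix (Fin m) (Fin n) (ZMod 2)}
    {v : Fin n → ZMod 2} (hv : IsMinWeightCodeword H v) : IsMinWeightOutside H ⊥ v :=
  ⟨hv.1, by simpa using hv.2.1, fun u hu hu0 => hv.2.2 u hu (by simpa using hu0)⟩

/-- **Kovalev–Dumer–Pryadko 2013, Theorem 1 (binary case): the support of a minimum-weight code
word of the code with parity-check matrix `H` forms a linked cluster on `G₁(H)`** — two positions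
being adjacent "iff there is a row in the parity check matrix which has non-zero values at both
positions". Cut form: every coordinate set `A` that meets the support without containing it is
joined to its outside by a row of `H` through support positions. (Printed for `q`-ary codes; the
binary case is what the tree's `ZMod 2` codes need — TODO(general form): `ZMod 2 ↦` any field.)
[cite: KovalevDumerPryadko2013, §4 Theorem 1] -/
theorem exists_crossing_row_of_isMinWeightCodeword {H : Matrix (Fin m) (Fin n) (ZMod 2)}
    {v : Fin n → ZMod 2} (hv : IsMinWeightCodeword H v)
    (A : Finset (Fin n)) (hA : ∃ i ∈ A, v i ≠ 0) (hAc : ∃ j ∉ A, v j ≠ 0) :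
    ∃ r i j, i ∈ A ∧ j ∉ A ∧ v i ≠ 0 ∧ v j ≠ 0 ∧ H r i ≠ 0 ∧ H r j ≠ 0 :=
  exists_crossing_row_of_isMinWeightOutside hv.isMinWeightOutside_bot A hA hAc

/-! ### CSS form: a minimum-weight logical `Z`-operator has `H_X`-linked support -/

/-- The row space of a binary matrix (span of its rows), e.g. the `Z`-stabilizers `rs(H_Z)` of a
CSS code. [cite: DumerKovalevPryadko2017, §5 (restriction c ∈ C⊥∖C)] -/
abbrev rowSpaceOf {mZ : ℕ} (HZ : Matrix (Fin mZ) (Fin n) (ZMod 2)) :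
    Submodule (ZMod 2) (Fin n → ZMod 2) :=
  Submodule.span (ZMod 2) (Set.range HZ)

/-- **CSS form of the linked-cluster lemma.** For a CSS pair `(H_X, H_Z)`: if `v` is a
minimum-weight logical `Z`-operator — `H_X v = 0`, `v ∉ rs(H_Z)`, and no lighter `u` with
`H_X u = 0` lies outside `rs(H_Z)` — then the support of `v` is a linked cluster of `G₁(H_X)`
(every non-trivial split is crossed by an X-check). Consequently, to certify `d_Z ≥ d` it suffices
to check that no `H_X`-linked cluster of size `< d` supports an element of `ker H_X ∖ rs(H_Z)`.
[cite: DumerKovalevPryadko2017, §5 Lemma 3 + IC algorithm for quantum stabilizer codes] -/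
theorem css_exists_crossing_row {mX mZ : ℕ} {HX : Matrix (Fin mX) (Fin n) (ZMod 2)}
    {HZ : Matrix (Fin mZ) (Fin n) (ZMod 2)} {v : Fin n → ZMod 2}
    (hv : IsMinWeightOutside HX (rowSpaceOf HZ) v)
    (A : Finset (Fin n)) (hA : ∃ i ∈ A, v i ≠ 0) (hAc : ∃ j ∉ A, v j ≠ 0) :
    ∃ r i j, i ∈ A ∧ j ∉ A ∧ v i ≠ 0 ∧ v j ≠ 0 ∧ HX r i ≠ 0 ∧ HX r j ≠ 0 :=
  exists_crossing_row_of_isMinWeightOutside hv A hA hAc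

end Literature.InformationTheory.QuantumCodes
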